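import Summits.MatrixMultiplication.MatrixMultiplication.Theorems.LevelGradedCohnUmansLevelOneLink

/-!
# The Lie engine tolerates a `p^{-δ}` loss: level-one `GL₂(𝔽_p)` designs of size `p^{3/2 − δ}` (every `δ > 0`)
already give `LieRankDesigns` (crux `LevelOneGL2Designs`, stmt-MatrixMultiplication-14080; wall-breaker axis
`parabola lifts over finite fields`, stub `stub_tangencySets`)

The crux `LevelOneGL2Designs` fixes the exponent `3/2` with a constant, and the disprover showed this window is
razor-thin (`c ∈ (0, 1/√2]`, exponent `> 3/2` refuted).  Its only consumer is `LevelOneLink :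
LevelOneGL2Designs → LieRankDesigns` (`levelOneLink_proof`), whose ε-bookkeeping compares the level-one budget
`≤ 4^s p^{1+s}` (`s = 2 + ε`) with the volume `(c p^{3/2})^s = c^s p^{1+s} · p^{ε/2}`: there is a POLYNOMIAL slack
`p^{ε/2}`.  Hence sizes `c · p^{3/2 − δ}` with `δ·s < ε/2` suffice.  This file proves exactly that:

* `lieRankDesigns_of_levelOneGL2Near` — if for EVERY `δ > 0` there is `c > 0` such that unboundedly many primes `p`
  carry rank-`1`-separated `X, Y, Z ⊆ GL₂(𝔽_p)` with `|X|, |Y|, |Z| ≥ c · p^{3/2 − δ}` (the crux with `p^{3/2}`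
  replaced by `p^{3/2−δ}`, quantified over all `δ > 0`), then `LieRankDesigns` holds (given `ε`, use
  `δ = ε/(4s)`, a prime `p > ((4/c)^s)^{4/ε}` of the family, `m = 2`, `k = 1`);
* `levelOneGL2Near_of_levelOneGL2Designs` — the crux implies this weaker hypothesis (so nothing is lost).

Why this matters for the stub: on the PACKING side the weakened exponent is a theorem — strong representative
systems of `AG(2,p)` of size `c_ε p^{3/2 − ε}` exist for every `ε > 0` along whole residue classes of primes
(`ParabolaLift.stubFormat_near_threeHalves[_progression]`, from Pohoata 2026 Thm 1.3, proved in the tree), while at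
exponent exactly `3/2` the stub is the open frontier.  So a route through level-one `GL₂` designs needs the crux
only in the `3/2 − δ` form, for which the packing input is settled; what remains is a TRANSFER from tangency sets
(or from the lifted number-ring structure directly) to rank-`1`-separated triples at size `p^{3/2−δ}` — and the
Roth mechanism that killed the flag architecture at exponent `3/2` (3-term geometric progressions in a ratio set
of positive density, `Cruxes/LevelOneGL2Designs/Lines/Sketch-dead.md` case (1)) is void at density `p^{−2δ}`
(Behrend-type product sets).  No definitions; the hypothesis is spelled out inline.
-/

-- `Summit.<Summit>.<Problem>` is the tree's mandated summit-side namespace; for this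
-- single-conjunct summit the two coincide, so the file silences `dupNamespace`.
set_option linter.dupNamespace false

noncomputable section

open scoped BigOperators

namespace Summit.MatrixMultiplication.MatrixMultiplication.Theorems.LevelOneGL2Designs.NearLink

open Summit.MatrixMultiplication.MatrixMultiplication.Theses.LevelGradedCohnUmans

/-- **The crux implies its `p^{−δ}`-weakening.**  If `LevelOneGL2Designs` holds (sizes `≥ c·p^{3/2}`) then for
every `δ > 0` the same family has sizes `≥ c·p^{3/2−δ}` (as `p ≥ 1`). [elementary] -/
theorem levelOneGL2Near_of_levelOneGL2Designs (h : LevelOneGL2Designs) :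
    ∀ δ : ℝ, 0 < δ → ∃ c : ℝ, 0 < c ∧ ∀ p₀ : ℕ, ∃ (p : ℕ) (_ : Fact p.Prime), p₀ ≤ p ∧
      ∃ X Y Z : Finset (Matrix.GeneralLinearGroup (Fin 2) (ZMod p)),
        (∀ x₀ ∈ X, ∀ z₀ ∈ Z, ∃ c : Matrix (Fin 2) (Fin 2) (ZMod p) → ℂ, (∀ M, 1 < M.rank → c M = 0) ∧
          ∀ x ∈ X, ∀ y ∈ Y, ∀ y' ∈ Y, ∀ z ∈ Z,
            (∑ M : Matrix (Fin 2) (Fin 2) (ZMod p), c M * ZMod.stdAddChar (Matrix.trace (M *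
              ((x⁻¹ * y * y'⁻¹ * z : Matrix.GeneralLinearGroup (Fin 2) (ZMod p)) :
                Matrix (Fin 2) (Fin 2) (ZMod p))))) = if x = x₀ ∧ y = y' ∧ z = z₀ then 1 else 0) ∧
        c * (p : ℝ) ^ (3 / 2 - δ : ℝ) ≤ X.card ∧ c * (p : ℝ) ^ (3 / 2 - δ : ℝ) ≤ Y.card ∧
          c * (p : ℝ) ^ (3 / 2 - δ : ℝ) ≤ Z.card := by
  intro δ hδ
  obtain ⟨c, hc, hall⟩ := h
  refine ⟨c, hc, fun p₀ => ?_⟩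
  obtain ⟨p, hp, hp₀, X, Y, Z, hsep, hX, hY, hZ⟩ := hall p₀
  have hp1 : (1 : ℝ) ≤ p := by exact_mod_cast hp.out.one_lt.le
  have hle : c * (p : ℝ) ^ (3 / 2 - δ : ℝ) ≤ c * (p : ℝ) ^ (3 / 2 : ℝ) :=
    mul_le_mul_of_nonneg_left (Real.rpow_le_rpow_of_exponent_le hp1 (by linarith)) hc.le
  exact ⟨p, hp, hp₀, X, Y, Z, hsep, hle.trans hX, hle.trans hY, hle.trans hZ⟩

/-- **The Lie engine tolerates a `p^{−δ}` loss** (`LieRankDesigns` from NEAR-`3/2` level-one designs).  Suppose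
that for every `δ > 0` there is `c > 0` such that for every `p₀` some prime `p ≥ p₀` carries
`X, Y, Z ⊆ GL₂(𝔽_p)` separated by Fourier-rank-`≤ 1` tests with `|X|, |Y|, |Z| ≥ c · p^{3/2 − δ}`.  Then
`LieRankDesigns`.  Proof: given `ε > 0` put `s = 2 + ε`, `δ = ε/(4s)`; in the `δ`-family (constant `c`) pick a
prime `p > max(3, ((4/c)^s)^{4/ε})`, `m = 2`, `k = 1`.  Budget `∑ᶠ_{Irr ∩ F₁} χ(1)^s ≤ (p+1)^{s−1}p² ≤ 4^s p^{1+s}`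
(`LevelOneLink.levelOne_budget_le`); volume `(|X||Y||Z|)^{s/3} ≥ (c p^{3/2−δ})^s = c^s p^{1+s} p^{ε/4}`; and
`4^s < c^s p^{ε/4}` by the choice of `p`.  (The bookkeeping of `levelOneLink_proof` with the slack `p^{ε/2}` split
in two.) [elementary, given the tree's level-one budget] -/
theorem lieRankDesigns_of_levelOneGL2Near
    (hnear : ∀ δ : ℝ, 0 < δ → ∃ c : ℝ, 0 < c ∧ ∀ p₀ : ℕ, ∃ (p : ℕ) (_ : Fact p.Prime), p₀ ≤ p ∧
      ∃ X Y Z : Finset (Matrix.GeneralLinearGroup (Fin 2) (ZMod p)),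
        (∀ x₀ ∈ X, ∀ z₀ ∈ Z, ∃ c : Matrix (Fin 2) (Fin 2) (ZMod p) → ℂ, (∀ M, 1 < M.rank → c M = 0) ∧
          ∀ x ∈ X, ∀ y ∈ Y, ∀ y' ∈ Y, ∀ z ∈ Z,
            (∑ M : Matrix (Fin 2) (Fin 2) (ZMod p), c M * ZMod.stdAddChar (Matrix.trace (M *
              ((x⁻¹ * y * y'⁻¹ * z : Matrix.GeneralLinearGroup (Fin 2) (ZMod p)) :
                Matrix (Fin 2) (Fin 2) (ZMod p))))) = if x = x₀ ∧ y = y' ∧ z = z₀ then 1 else 0) ∧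
        c * (p : ℝ) ^ (3 / 2 - δ : ℝ) ≤ X.card ∧ c * (p : ℝ) ^ (3 / 2 - δ : ℝ) ≤ Y.card ∧
          c * (p : ℝ) ^ (3 / 2 - δ : ℝ) ≤ Z.card) :
    LieRankDesigns := by
  intro ε hε
  set s : ℝ := 2 + ε with hs_def
  have hs : 0 < s := by rw [hs_def]; linarith
  have hs1 : 1 ≤ s := by rw [hs_def]; linarith
  -- the loss exponent `δ = ε / (4 s)`, so that `δ s = ε / 4`
  set δ : ℝ := ε / (4 * s) with hδ_def
  have hδ : 0 < δ := by rw [hδ_def]; positivity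
  have hδs : δ * s = ε / 4 := by
    rw [hδ_def]; field_simp
  obtain ⟨c, hc, hall⟩ := hnear δ hδ
  set K : ℝ := (4 / c) ^ s with hK_def
  have hK : 0 ≤ K := by rw [hK_def]; positivity
  obtain ⟨N, hN⟩ := exists_nat_gt (max 3 (K ^ (4 / ε)))
  obtain ⟨p, hprime, hNp, X, Y, Z, hsep, hX, hY, hZ⟩ := hall N
  have hNR : (N : ℝ) ≤ p := by exact_mod_cast hNp
  have hp3 : (3 : ℝ) < p := lt_of_lt_of_le (lt_of_le_of_lt (le_max_left _ _) hN) hNR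
  have hpK : K ^ (4 / ε) < p := lt_of_lt_of_le (lt_of_le_of_lt (le_max_right _ _) hN) hNR
  have hp0 : (0 : ℝ) < p := by linarith
  -- the key threshold: `K < p ^ (ε/4)`
  have hKp : K < (p : ℝ) ^ (ε / 4) := by
    have h1 : (K ^ (4 / ε)) ^ (ε / 4) < (p : ℝ) ^ (ε / 4) :=
      Real.rpow_lt_rpow (by positivity) hpK (by positivity)
    have h2 : (K ^ (4 / ε)) ^ (ε / 4) = K := by
      rw [← Real.rpow_mul hK]
      have : (4 / ε) * (ε / 4) = 1 := by field_simp
      rw [this, Real.rpow_one]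
    rwa [h2] at h1
  refine ⟨p, hprime, 2, 1, X, Y, Z, hsep, ?_⟩
  have hb := LevelOneLink.levelOne_budget_le p s hs1
  -- budget: `(p+1)^(s-1) p² ≤ 4^s p^(1+s)`
  have hbud : ((p : ℝ) + 1) ^ (s - 1) * (p : ℝ) ^ 2 ≤ (4 : ℝ) ^ s * (p : ℝ) ^ (1 + s) := by
    have h1 : ((p : ℝ) + 1) ^ (s - 1) ≤ (2 * (p : ℝ)) ^ (s - 1) :=
      Real.rpow_le_rpow (by positivity) (by linarith) (by linarith)
    have h2 : (2 * (p : ℝ)) ^ (s - 1) * (p : ℝ) ^ 2 = (2 : ℝ) ^ (s - 1) * (p : ℝ) ^ (1 + s) := by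
      rw [Real.mul_rpow (by norm_num) hp0.le, mul_assoc, ← Real.rpow_two, ← Real.rpow_add hp0]
      congr 1
      ring_nf
    have h3 : (2 : ℝ) ^ (s - 1) ≤ (4 : ℝ) ^ s := by
      rw [show (4 : ℝ) = 2 ^ (2 : ℝ) by norm_num, ← Real.rpow_mul (by norm_num)]
      exact Real.rpow_le_rpow_of_exponent_le (by norm_num) (by linarith)
    have h4 : (0 : ℝ) ≤ (p : ℝ) ^ (1 + s) := Real.rpow_nonneg hp0.le _
    have h5 : (0 : ℝ) ≤ (p : ℝ) ^ 2 := by positivity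
    calc ((p : ℝ) + 1) ^ (s - 1) * (p : ℝ) ^ 2 ≤ (2 * (p : ℝ)) ^ (s - 1) * (p : ℝ) ^ 2 :=
          mul_le_mul_of_nonneg_right h1 h5
      _ = (2 : ℝ) ^ (s - 1) * (p : ℝ) ^ (1 + s) := h2
      _ ≤ (4 : ℝ) ^ s * (p : ℝ) ^ (1 + s) := mul_le_mul_of_nonneg_right h3 h4
  -- volume: `(c p^{3/2-δ})^3 ≤ |X||Y||Z|`
  have hc32 : 0 < c * (p : ℝ) ^ (3 / 2 - δ : ℝ) := by positivity
  have hXpos : (0 : ℝ) < X.card := lt_of_lt_of_le hc32 hX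
  have hYpos : (0 : ℝ) < Y.card := lt_of_lt_of_le hc32 hY
  have hV : (c * (p : ℝ) ^ (3 / 2 - δ : ℝ)) ^ (3 : ℕ) ≤ ((X.card * Y.card * Z.card : ℕ) : ℝ) := by
    push_cast
    have := mul_le_mul (mul_le_mul hX hY hc32.le hXpos.le) hZ hc32.le (by positivity)
    nlinarith [this]
  have hV' : ((c * (p : ℝ) ^ (3 / 2 - δ : ℝ)) ^ (3 : ℕ)) ^ (s / 3) ≤
      ((X.card * Y.card * Z.card : ℕ) : ℝ) ^ (s / 3) :=
    Real.rpow_le_rpow (by positivity) hV (by positivity)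
  have hV'' : ((c * (p : ℝ) ^ (3 / 2 - δ : ℝ)) ^ (3 : ℕ)) ^ (s / 3) =
      c ^ s * ((p : ℝ) ^ (1 + s) * (p : ℝ) ^ (ε / 4)) := by
    rw [← Real.rpow_natCast, ← Real.rpow_mul hc32.le]
    have h3 : ((3 : ℕ) : ℝ) * (s / 3) = s := by push_cast; ring
    rw [h3, Real.mul_rpow hc.le (by positivity), ← Real.rpow_mul hp0.le, ← Real.rpow_add hp0]
    congr 1
    congr 1
    have : (3 / 2 - δ) * s = 3 / 2 * s - δ * s := by ring
    rw [this, hδs, hs_def]; ring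
  -- combine
  have hfinal : (4 : ℝ) ^ s * (p : ℝ) ^ (1 + s) <
      c ^ s * ((p : ℝ) ^ (1 + s) * (p : ℝ) ^ (ε / 4)) := by
    have hcs : 0 < c ^ s := Real.rpow_pos_of_pos hc s
    have hp1s : 0 < (p : ℝ) ^ (1 + s) := Real.rpow_pos_of_pos hp0 _
    have hKc : c ^ s * K = (4 : ℝ) ^ s := by
      rw [hK_def, Real.div_rpow (by norm_num) hc.le]
      field_simp
    calc (4 : ℝ) ^ s * (p : ℝ) ^ (1 + s) = c ^ s * ((p : ℝ) ^ (1 + s) * K) := by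
          rw [← hKc]; ring
      _ < c ^ s * ((p : ℝ) ^ (1 + s) * (p : ℝ) ^ (ε / 4)) := by gcongr
  calc _ ≤ ((p : ℝ) + 1) ^ (s - 1) * (p : ℝ) ^ 2 := hb
    _ ≤ (4 : ℝ) ^ s * (p : ℝ) ^ (1 + s) := hbud
    _ < c ^ s * ((p : ℝ) ^ (1 + s) * (p : ℝ) ^ (ε / 4)) := hfinal
    _ = ((c * (p : ℝ) ^ (3 / 2 - δ : ℝ)) ^ (3 : ℕ)) ^ (s / 3) := hV''.symm
    _ ≤ ((X.card * Y.card * Z.card : ℕ) : ℝ) ^ (s / 3) := hV'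

end Summit.MatrixMultiplication.MatrixMultiplication.Theorems.LevelOneGL2Designs.NearLink
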